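import Summits.Schanuel.Schanuel.Theses.BenfordTowers
import Literature.NumberTheory.UniformDistribution.KroneckerSequence
import Literature.NumberTheory.UniformDistribution.CubeTestFunctions

/-!
# Birth skeleton — piece `BenfordTowers.BenfordOfHom` (stmt-Schanuel-11406), line `birth` (ratio chart → tower structure → skew Kronecker–Weyl)

Piece 2 (the PROVABLE half `T → X`) of the dictionary split
`BenfordFamily ⇐ HomPrimeLogSector ∧ BenfordOfHom` (crux strategist of stmt-Schanuel-11400, BC2
redirect, 2026-08-17).  `BenfordOfHom : HomPrimeLogSector → BenfordFamily` is the sufficiency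
direction of the route's dictionary (refuter-checked on paper, rreview-0815T17: "sound in outline").

Three stubs along the actual proof architecture, none of them the piece reworded:

* `stub_ratioAlgIndep_of_hom` (ALGEBRA, M) — AFFINE CHART OF THE PROJECTIVE SECTOR: no homogeneous
  relation among logs of distinct primes ⇒ for every prime base `B` the ratios `log_B p`
  (`p` prime `≠ B`, any index type, injective) are ALGEBRAICALLY INDEPENDENT over `ℚ`
  (dehomogenise/homogenise with the fresh variable `X_B`; finite-support reduction of
  `AlgebraicIndependent`).
* `stub_towerStructure` (COMBINATORICS + REAL ANALYSIS, M/L) — THE TOWER STRUCTURE THEOREM: for an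
  admissible single-level family `F` with non-zero symbol there are finitely many frequencies
  `θ₁` (values of the distinct TOP monomials, degree `k+1`) and `θ₂` (distinct PREFIX monomials,
  degree `≤ k`) in the `log_B p`, an INTEGER vector `c ≠ 0` (the symbol's coefficients) and a
  bracket function `Φ` of the prefix coordinates only, continuous off a closed Lebesgue-null set
  (finitely many affine hyperplane pieces), such that for every integer frequency `h` and every
  `n`, `e(h·S_F(n)) = e(h·(∑ᵢ cᵢ{nθ₁ᵢ} + Φ({nθ₂})))` — the level-by-level unwinding
  `e_j = ⌊e_{j-1} log_B p_j⌋ + 1 = n·π_j + G_j({nπ_1},…,{nπ_j})` (`Nat.digits_len`, `⌊·⌋ = · − {·}`)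
  — and such that algebraic independence of the `log_B p` over the primes of `F` makes
  `(1, θ₁, θ₂)` `ℚ`-linearly independent (distinct monomials).
* `stub_skewWeyl` (EQUIDISTRIBUTION ENGINE, M/L) — SKEW KRONECKER–WEYL WITH A RIEMANN-INTEGRABLE
  FIBRE FACTOR: if `(1, θ₁, θ₂)` is `ℚ`-linearly independent, `c ∈ ℤ^{m₁} ∖ 0` and `Φ` is continuous
  off a closed null set, then `∑_{n<N} e(h(∑ cᵢ{nθ₁ᵢ} + Φ({nθ₂}))) = o(N)` for `h ≠ 0`: Kronecker–Weyl
  for `n(θ₁,θ₂)` (tree `equidistributedModOnePi_nat_mul_fin`), K–N Thm 6.1 extended from continuous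
  to Riemann-integrable test functions (tree `tendsto_fractAvgPi_of_riemannSum` + squeeze), Fubini and
  `∫₀¹ e(h cᵢ y) dy = 0` (tree `setIntegral_exp_two_pi_mul_sum_eq_zero`).
* `BenfordOfHom_of` — composition (real proof): chart ⇒ algebraic independence of the ratios over
  the primes of `F` ⇒ structure data with `(1,θ₁,θ₂)` free ⇒ rewrite the Weyl sum of `h·S_F`
  termwise by the structure identity ⇒ skew Kronecker–Weyl.
-/

noncomputable section

open scoped BigOperators
open Filter

namespace Summit.Schanuel.Schanuel.Cruxes.BenfordOfHom.Birth

open Summit.Schanuel.Schanuel.Theses.BenfordTowers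

/-- stub (algebra, M): the affine chart — `HomPrimeLogSector` ⇒ for every prime base `B`, the
family `(log_B p)` over any injectively indexed set of primes `≠ B` is algebraically independent
over `ℚ`. [Waldschmidt2005 §1; Lang1966; route item 11402 docstring ("equivalently the ratios …")] -/
theorem stub_ratioAlgIndep_of_hom :
    HomPrimeLogSector →
      ∀ (B : ℕ) {ι : Type} (ℓ : ι → ℕ), B.Prime → (∀ i, (ℓ i).Prime ∧ ℓ i ≠ B) →
        Function.Injective ℓ → AlgebraicIndependent ℚ (fun i => Real.logb B (ℓ i)) := by
  sorry

/-- stub (combinatorics + real analysis, M/L): the TOWER STRUCTURE THEOREM for admissible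
single-level families with non-zero symbol (see the module docstring). [Haland1993; Haland1994;
BergelsonLeibman2007 §0; KuipersNiederreiter1974 Ch. 1 §6; Diaconis1977] -/
theorem stub_towerStructure :
    ∀ (B k : ℕ) (F : List (ℤ × List ℕ × ℕ)), B.Prime →
      (∀ m ∈ F, m.2.1.length = k ∧ (∀ p ∈ m.2.1, p.Prime ∧ p ≠ B) ∧ m.2.2.Prime ∧ m.2.2 ≠ B) →
      (F.map fun m => MvPolynomial.C (m.1 : ℚ) * (m.2.1.map (MvPolynomial.X (R := ℚ))).prod *
          MvPolynomial.X m.2.2).sum ≠ (0 : MvPolynomial ℕ ℚ) →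
      ∃ (m₁ m₂ : ℕ) (θ₁ : Fin m₁ → ℝ) (θ₂ : Fin m₂ → ℝ) (c : Fin m₁ → ℤ) (Φ : (Fin m₂ → ℝ) → ℝ)
        (Z : Set (Fin m₂ → ℝ)),
        c ≠ 0 ∧ IsClosed Z ∧ MeasureTheory.volume Z = 0 ∧ ContinuousOn Φ (Set.Icc 0 1 \ Z) ∧
        (AlgebraicIndependent ℚ
            (fun p : {p : ℕ // ∃ m ∈ F, p ∈ m.2.1 ∨ p = m.2.2} => Real.logb B (p : ℕ)) →
          LinearIndependent ℚ (Fin.cons (1 : ℝ) (Fin.append θ₁ θ₂))) ∧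
        ∀ (h : ℤ) (n : ℕ),
          Complex.exp (2 * Real.pi * Complex.I * (((h : ℝ) *
            (F.map fun m => (m.1 : ℝ) *
              ((m.2.1.foldl (fun e p => (Nat.digits B (p ^ e)).length) n : ℕ) : ℝ) *
              Real.logb B m.2.2).sum : ℝ) : ℂ))
          = Complex.exp (2 * Real.pi * Complex.I * (((h : ℝ) *
            (∑ i, (c i : ℝ) * Int.fract ((n : ℝ) * θ₁ i) +
              Φ (fun j => Int.fract ((n : ℝ) * θ₂ j))) : ℝ) : ℂ)) := by
  sorry

/-- stub (equidistribution engine, M/L): skew Kronecker–Weyl with a Riemann-integrable fibre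
factor (see the module docstring). [KuipersNiederreiter1974 Ch. 1 Thm 6.1 and Ex. 6.1; Weyl1916;
tree `equidistributedModOnePi_nat_mul_fin`, `setIntegral_exp_two_pi_mul_sum_eq_zero`] -/
theorem stub_skewWeyl :
    ∀ (m₁ m₂ : ℕ) (θ₁ : Fin m₁ → ℝ) (θ₂ : Fin m₂ → ℝ) (c : Fin m₁ → ℤ) (Φ : (Fin m₂ → ℝ) → ℝ)
      (Z : Set (Fin m₂ → ℝ)),
      LinearIndependent ℚ (Fin.cons (1 : ℝ) (Fin.append θ₁ θ₂)) → c ≠ 0 →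
      IsClosed Z → MeasureTheory.volume Z = 0 → ContinuousOn Φ (Set.Icc 0 1 \ Z) →
      ∀ h : ℤ, h ≠ 0 →
        (fun N : ℕ => ∑ n ∈ Finset.range N,
            Complex.exp (2 * Real.pi * Complex.I * (((h : ℝ) *
              (∑ i, (c i : ℝ) * Int.fract ((n : ℝ) * θ₁ i) +
                Φ (fun j => Int.fract ((n : ℝ) * θ₂ j))) : ℝ) : ℂ)))
          =o[atTop] fun N : ℕ => (N : ℝ) := by
  sorry

/-- COMPOSITION (real proof, the stubs used BY NAME): the three stubs imply the piece
`BenfordOfHom`. -/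
theorem BenfordOfHom_of : BenfordOfHom := by
  have hChart := stub_ratioAlgIndep_of_hom
  have hStruct := stub_towerStructure
  have hWeyl := stub_skewWeyl
  intro hHom B k F hB hF hsym h hh
  obtain ⟨m₁, m₂, θ₁, θ₂, c, Φ, Z, hc, hZc, hZ0, hΦ, hli, hid⟩ := hStruct B k F hB hF hsym
  -- algebraic independence of the ratios over the primes of `F`, from the chart
  have hprimes : ∀ p : {p : ℕ // ∃ m ∈ F, p ∈ m.2.1 ∨ p = m.2.2}, (p : ℕ).Prime ∧ (p : ℕ) ≠ B := by
    rintro ⟨p, m, hm, hp⟩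
    rcases hp with hp | rfl
    · exact (hF m hm).2.1 p hp
    · exact (hF m hm).2.2
  have hAI : AlgebraicIndependent ℚ
      (fun p : {p : ℕ // ∃ m ∈ F, p ∈ m.2.1 ∨ p = m.2.2} => Real.logb B (p : ℕ)) :=
    hChart hHom B (fun p : {p : ℕ // ∃ m ∈ F, p ∈ m.2.1 ∨ p = m.2.2} => (p : ℕ)) hB hprimes
      Subtype.coe_injective
  have hLI := hli hAI
  have heq : (fun N : ℕ => ∑ n ∈ Finset.range N,
      Complex.exp (2 * Real.pi * Complex.I * (((h : ℝ) *
        (F.map fun m => (m.1 : ℝ) *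
          ((m.2.1.foldl (fun e p => (Nat.digits B (p ^ e)).length) n : ℕ) : ℝ) *
          Real.logb B m.2.2).sum : ℝ) : ℂ))) =
      (fun N : ℕ => ∑ n ∈ Finset.range N,
        Complex.exp (2 * Real.pi * Complex.I * (((h : ℝ) *
          (∑ i, (c i : ℝ) * Int.fract ((n : ℝ) * θ₁ i) +
            Φ (fun j => Int.fract ((n : ℝ) * θ₂ j))) : ℝ) : ℂ))) := by
    funext N
    exact Finset.sum_congr rfl fun n _ => hid h n
  rw [heq]
  exact hWeyl m₁ m₂ θ₁ θ₂ c Φ Z hLI hc hZc hZ0 hΦ h hh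

end Summit.Schanuel.Schanuel.Cruxes.BenfordOfHom.Birth

end
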